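import Summits.ValiantsHypothesis.ValiantsHypothesis.Theses.OneNatPerBit
import Literature.Analysis.Matrix.PermanentHadamard

/-!
# Route OneNatPerBit — item `ProductAnchor` (stmt-ValiantsHypothesis-10324)

The `w = 1` / `s ≈ n²` intercept of the route's correlation law is the Carlen–Lieb–Loss
inequality of Hadamard type for permanents (Methods Appl. Anal. 13 (2006) 1–17, Thm. 1.1):
for every complex `n × n` array `a`,
`|Σ_σ Π_i a_{i,σ i}|² · nⁿ ≤ (n!)² · Π_i Σ_j |a_{ij}|²`,
i.e. `corr²(Π_i Σ_j a_{ij} x_{ij}, per_n) ≤ n!/nⁿ`.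

The theorem is PROVED in the tree (`Literature.Analysis.Matrix.carlenLiebLoss_permanent_sq_le_holds`,
the paper's second, elementary proof via the `K`-row sub-permanent bound Thm. 3.1); this file only
transports it to the route declaration: `Σ_σ Π_i a i (σ i)` is by definition Mathlib's
`Matrix.permanent` of the matrix `M i j := a j i` (`permanent M = Σ_σ Π_i M (σ i) i`), and the
column-norm product of `M` is the row-norm product of `a`.
-/

set_option linter.dupNamespace false -- single-conjunct summit: `ValiantsHypothesis.ValiantsHypothesis`

namespace Summit.ValiantsHypothesis.ValiantsHypothesis.Theorems

/-- **ProductAnchor** (route OneNatPerBit, item stmt-ValiantsHypothesis-10324; Carlen–Lieb–Loss 2006,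
Thm. 1.1 in squared correlation form): for every `n` and every complex array `a : Fin n → Fin n → ℂ`,
`‖Σ_σ Π_i a i (σ i)‖² · nⁿ ≤ (n!)² · Π_i Σ_j ‖a i j‖²`. Proof: the in-tree discharge
`Literature.Analysis.Matrix.carlenLiebLoss_permanent_sq_le_holds` applied to the matrix
`Matrix.of fun i j => a j i`, whose permanent is literally the route's sum over permutations. -/
theorem productAnchor_proof :
    Summit.ValiantsHypothesis.ValiantsHypothesis.Theses.OneNatPerBit.ProductAnchor := by
  unfold Summit.ValiantsHypothesis.ValiantsHypothesis.Theses.OneNatPerBit.ProductAnchor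
  intro n a
  have h := Literature.Analysis.Matrix.carlenLiebLoss_permanent_sq_le_holds n
    (Matrix.of fun i j => a j i)
  simpa only [Matrix.permanent, Matrix.of_apply] using h

end Summit.ValiantsHypothesis.ValiantsHypothesis.Theorems
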